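import Mathlib
import Summits.Ventures.HodgeRepro2.Tier7.Target

/-!
# Tier7/Line1/TwoConstituents — Hecke-stable subspaces of a sum of two non-isomorphic irreducibles (t7-L1-p4)

Cell pub-hodge-repro2, Tier 7, LINE L1, prover t7-L1-p4 — generic module theory for t7-L1-p2's separating datum
(design l. 14712 (3): «`H10*H10 = P_A ⊕ P_B`, whose Hecke-stable subspaces are exactly `{0, P_A, P_B, all}` ⇒ (H9) and
(H10) hold»). Sorry-free; imports Mathlib + `Tier7.Target` (for `HeckeStable`, `HeckeIrred`). The Hecke group `G` is
a bare group acting on `HX`; the one linearity axiom of the action that is used (`hadd : g • (a + b) = g • a + g • b`)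
is a hypothesis, to be fed from `SurfaceShadow.act_add`.

THEOREM (`stable_le_sup_cases`). Let `W, W'` be Hecke-irreducible with `W ⊓ W' = ⊥`, and suppose there is NO non-zero
Hecke-equivariant linear map `W' → W` (`NoEquivariantMap`, the shape of (H10) `H20_multone`). Then every Hecke-stable
`U ≤ W ⊔ W'` is one of `⊥, W, W', W ⊔ W'`. Proof: if `U ⊓ W ≠ ⊥` then `W ≤ U` and the modular law gives
`U = W ⊔ (U ⊓ W')`; if `U ⊓ W = ⊥`, the `W'`-component map `U → W'` is injective with stable image, so its image is
`⊥` (then `U = ⊥`) or `W'`; in the latter case «the `W`-component as a function of the `W'`-component» is an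
equivariant linear map `W' → W`, which the hypothesis makes zero, so `U ≤ W'`, so `U = W'`.
COROLLARIES in the shape of the datum's fields: `exists_compl_of_two` (every stable `U ≤ W ⊔ W'` has a stable
complement in `W ⊔ W'`), `exists_irred_le_of_two` (a non-zero stable `U ≤ W ⊔ W'` contains an irreducible) and
`eq_of_equivariant_of_two` (two irreducibles inside `W ⊔ W'` with a non-zero equivariant map between them coincide),
given `NoEquivariantMap` in BOTH directions.

§8(d): NO.
-/

namespace Summit.Ventures.HodgeRepro2.Tier7.Line1

open Summit.Ventures.HodgeRepro2.Tier7

noncomputable section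

variable {HX : Type} [Ring HX] [Algebra ℂ HX] {G : Type} [Group G] [MulAction G HX]

/-- «no non-zero Hecke-equivariant linear map from `W'` into `W`», in the shape of (H10) `H20_multone` -/
def NoEquivariantMap (G : Type) [Group G] [MulAction G HX] (W' W : Submodule ℂ HX)
    (hW' : HeckeStable G W') : Prop :=
  ∀ φ : W' →ₗ[ℂ] HX, (∀ x : W', φ x ∈ W) →
    (∀ (g : G) (x : W'), φ ⟨g • (x : HX), hW' g x x.2⟩ = g • φ x) → φ = 0

/-! ## 1. Components along `W ⊕ W'` -/

section Components

variable (W W' : Submodule ℂ HX)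

/-- uniqueness of the decomposition along `W ⊕ W'` -/
theorem eq_of_add_eq_add (hdisj : W ⊓ W' = ⊥) {w v : HX} (hw : w ∈ W) (hv : v ∈ W) {w' v' : HX}
    (hw' : w' ∈ W') (hv' : v' ∈ W') (h : w + w' = v + v') : w = v ∧ w' = v' := by
  have h1 : w - v ∈ W := W.sub_mem hw hv
  have h2 : w - v ∈ W' := by
    have : w - v = v' - w' := by
      rw [sub_eq_sub_iff_add_eq_add, h, add_comm]
    rw [this]
    exact W'.sub_mem hv' hw'
  have h3 : w - v ∈ W ⊓ W' := ⟨h1, h2⟩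
  rw [hdisj, Submodule.mem_bot, sub_eq_zero] at h3
  refine ⟨h3, ?_⟩
  rw [h3] at h
  exact add_left_cancel h

open scoped Classical in
/-- the `W`-component of an element of `W ⊔ W'` (chosen; `0` outside `W ⊔ W'`) -/
def c₁ (t : HX) : HX :=
  if h : t ∈ W ⊔ W' then Classical.choose (Submodule.mem_sup.mp h) else 0

open scoped Classical in
/-- the `W'`-component of an element of `W ⊔ W'` (chosen; `0` outside `W ⊔ W'`) -/
def c₂ (t : HX) : HX :=
  if h : t ∈ W ⊔ W' then Classical.choose (Classical.choose_spec (Submodule.mem_sup.mp h)).2 else 0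

/-- the `W`-component lies in `W` -/
theorem c₁_mem (t : HX) : c₁ W W' t ∈ W := by
  unfold c₁
  split_ifs with h
  · exact (Classical.choose_spec (Submodule.mem_sup.mp h)).1
  · exact W.zero_mem

/-- the `W'`-component lies in `W'` -/
theorem c₂_mem (t : HX) : c₂ W W' t ∈ W' := by
  unfold c₂
  split_ifs with h
  · exact (Classical.choose_spec (Classical.choose_spec (Submodule.mem_sup.mp h)).2).1
  · exact W'.zero_mem

/-- the components add up to the element -/
theorem c_add {t : HX} (ht : t ∈ W ⊔ W') : c₁ W W' t + c₂ W W' t = t := by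
  unfold c₁ c₂
  rw [dif_pos ht, dif_pos ht]
  exact (Classical.choose_spec (Classical.choose_spec (Submodule.mem_sup.mp ht)).2).2

/-- the components are determined by any decomposition -/
theorem c_eq (hdisj : W ⊓ W' = ⊥) {t : HX} (ht : t ∈ W ⊔ W') {w w' : HX} (hw : w ∈ W) (hw' : w' ∈ W')
    (h : w + w' = t) : c₁ W W' t = w ∧ c₂ W W' t = w' :=
  eq_of_add_eq_add W W' hdisj (c₁_mem W W' t) hw (c₂_mem W W' t) hw' (by rw [c_add W W' ht, h])

end Components

/-! ## 2. The four cases -/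

section Main

variable (hadd : ∀ (g : G) (a b : HX), g • (a + b) = g • a + g • b)

include hadd in
/-- THE FOUR CASES: a Hecke-stable subspace of `W ⊔ W'` is `⊥`, `W`, `W'` or `W ⊔ W'` when `W, W'` are irreducible,
disjoint, and there is no non-zero equivariant map `W' → W`. -/
theorem stable_le_sup_cases {W W' U : Submodule ℂ HX} (hW : HeckeIrred G W) (hW' : HeckeIrred G W')
    (hdisj : W ⊓ W' = ⊥) (hhom : NoEquivariantMap G W' W hW'.2.1) (hU : HeckeStable G U)
    (hle : U ≤ W ⊔ W') : U = ⊥ ∨ U = W ∨ U = W' ∨ U = W ⊔ W' := by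
  by_cases hUW : U ⊓ W = ⊥
  · -- Case B: `U ⊓ W = ⊥`
    by_cases hUbot : U = ⊥
    · exact Or.inl hUbot
    · -- the components of elements of `U` are additive, `ℂ`-linear and equivariant
      have hc_smul : ∀ (g : G) (u : HX), u ∈ U →
          c₁ W W' (g • u) = g • c₁ W W' u ∧ c₂ W W' (g • u) = g • c₂ W W' u := fun g u hu =>
        c_eq W W' hdisj (hle (hU g u hu)) (hW.2.1 g _ (c₁_mem W W' u)) (hW'.2.1 g _ (c₂_mem W W' u))
          (by rw [← hadd, c_add W W' (hle hu)])
      have hc_add : ∀ (u v : HX), u ∈ U → v ∈ U →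
          c₁ W W' (u + v) = c₁ W W' u + c₁ W W' v ∧ c₂ W W' (u + v) = c₂ W W' u + c₂ W W' v :=
        fun u v hu hv =>
        c_eq W W' hdisj (hle (U.add_mem hu hv)) (W.add_mem (c₁_mem W W' u) (c₁_mem W W' v))
          (W'.add_mem (c₂_mem W W' u) (c₂_mem W W' v))
          (by rw [add_add_add_comm, c_add W W' (hle hu), c_add W W' (hle hv)])
      have hc_smulc : ∀ (c : ℂ) (u : HX), u ∈ U →
          c₁ W W' (c • u) = c • c₁ W W' u ∧ c₂ W W' (c • u) = c • c₂ W W' u := fun c u hu =>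
        c_eq W W' hdisj (hle (U.smul_mem c hu)) (W.smul_mem c (c₁_mem W W' u))
          (W'.smul_mem c (c₂_mem W W' u)) (by rw [← smul_add, c_add W W' (hle hu)])
      -- an element of `U` with zero `W'`-component is zero
      have hker : ∀ u : HX, u ∈ U → c₂ W W' u = 0 → u = 0 := by
        intro u hu h0
        have h1 : u ∈ W := by
          have := c_add W W' (hle hu)
          rw [h0, add_zero] at this
          rw [← this]
          exact c₁_mem W W' u
        have : u ∈ U ⊓ W := ⟨hu, h1⟩
        rw [hUW, Submodule.mem_bot] at this
        exact this
      -- the image of the `W'`-component map on `U`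
      let I : Submodule ℂ HX :=
        { carrier := {x | ∃ u ∈ U, c₂ W W' u = x}
          add_mem' := by
            rintro x y ⟨u, hu, rfl⟩ ⟨v, hv, rfl⟩
            exact ⟨u + v, U.add_mem hu hv, (hc_add u v hu hv).2⟩
          zero_mem' := ⟨0, U.zero_mem, (c_eq W W' hdisj (hle U.zero_mem) W.zero_mem W'.zero_mem (add_zero 0)).2⟩
          smul_mem' := by
            rintro c x ⟨u, hu, rfl⟩
            exact ⟨c • u, U.smul_mem c hu, (hc_smulc c u hu).2⟩ }
      have hI_mem : ∀ x, x ∈ I ↔ ∃ u ∈ U, c₂ W W' u = x := fun _ => Iff.rfl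
      have hI_le : I ≤ W' := by
        rintro _ ⟨u, _, rfl⟩
        exact c₂_mem W W' u
      have hI_stable : HeckeStable G I := by
        rintro g _ ⟨u, hu, rfl⟩
        exact ⟨g • u, hU g u hu, (hc_smul g u hu).2⟩
      rcases hW'.2.2 I hI_le hI_stable with hIbot | hItop
      · -- every element of `U` has zero `W'`-component, so `U = ⊥`
        exfalso
        apply hUbot
        rw [eq_bot_iff]
        intro u hu
        have : c₂ W W' u ∈ I := ⟨u, hu, rfl⟩
        rw [hIbot, Submodule.mem_bot] at this
        rw [Submodule.mem_bot]
        exact hker u hu this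
      · -- the `W`-component as a function of the `W'`-component: an equivariant map `W' → W`, hence zero
        have hsurj : ∀ x ∈ W', ∃ u ∈ U, c₂ W W' u = x := by
          intro x hx
          exact (hI_mem x).mp (hItop ▸ hx)
        choose! lift hlift_mem hlift_comp using hsurj
        have hlift_unique : ∀ x ∈ W', ∀ u ∈ U, c₂ W W' u = x → u = lift x := by
          intro x hx u hu hcu
          have hneg : c₂ W W' ((-1 : ℂ) • lift x) = (-1 : ℂ) • c₂ W W' (lift x) :=
            (hc_smulc _ _ (hlift_mem x hx)).2
          have hsum := (hc_add u ((-1 : ℂ) • lift x) hu (U.smul_mem _ (hlift_mem x hx))).2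
          rw [hneg, hcu, hlift_comp x hx] at hsum
          have hzero : x + (-1 : ℂ) • x = 0 := by rw [neg_one_smul, add_neg_cancel]
          rw [hzero] at hsum
          have := hker _ (U.add_mem hu (U.smul_mem _ (hlift_mem x hx))) hsum
          rw [neg_one_smul, add_neg_eq_zero] at this
          exact this
        let φ : W' →ₗ[ℂ] HX :=
          { toFun := fun x => c₁ W W' (lift x)
            map_add' := by
              intro x y
              have hmem : lift x + lift y ∈ U := U.add_mem (hlift_mem x x.2) (hlift_mem y y.2)
              have hc : c₂ W W' (lift x + lift y) = (x : HX) + y := by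
                rw [(hc_add _ _ (hlift_mem x x.2) (hlift_mem y y.2)).2, hlift_comp x x.2, hlift_comp y y.2]
              have := hlift_unique _ (x + y).2 _ hmem hc
              rw [Submodule.coe_add] at this
              show c₁ W W' (lift ((x : HX) + y)) = c₁ W W' (lift x) + c₁ W W' (lift y)
              rw [← (hc_add _ _ (hlift_mem x x.2) (hlift_mem y y.2)).1, ← this]
            map_smul' := by
              intro c x
              have hmem : c • lift x ∈ U := U.smul_mem c (hlift_mem x x.2)
              have hc : c₂ W W' (c • lift x) = c • (x : HX) := by
                rw [(hc_smulc _ _ (hlift_mem x x.2)).2, hlift_comp x x.2]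
              have := hlift_unique _ (c • x).2 _ hmem hc
              rw [Submodule.coe_smul] at this
              show c₁ W W' (lift (c • (x : HX))) = c • c₁ W W' (lift x)
              rw [← (hc_smulc _ _ (hlift_mem x x.2)).1, ← this] }
        have hφW : ∀ x : W', φ x ∈ W := fun x => c₁_mem W W' _
        have hφeq : ∀ (g : G) (x : W'), φ ⟨g • (x : HX), hW'.2.1 g x x.2⟩ = g • φ x := by
          intro g x
          have hmem : g • lift x ∈ U := hU g _ (hlift_mem x x.2)
          have hc : c₂ W W' (g • lift x) = g • (x : HX) := by
            rw [(hc_smul _ _ (hlift_mem x x.2)).2, hlift_comp x x.2]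
          have := hlift_unique _ (hW'.2.1 g x x.2) _ hmem hc
          show c₁ W W' (lift (g • (x : HX))) = g • c₁ W W' (lift x)
          rw [← (hc_smul _ _ (hlift_mem x x.2)).1, ← this]
        have hφ0 : φ = 0 := hhom φ hφW hφeq
        -- hence every element of `U` lies in `W'`
        have hUle : U ≤ W' := by
          intro u hu
          have hx : c₂ W W' u ∈ W' := c₂_mem W W' u
          have hu' : u = lift (c₂ W W' u) := hlift_unique _ hx u hu rfl
          have h1 : c₁ W W' (lift (c₂ W W' u)) = 0 := by
            have := congrArg (fun f : W' →ₗ[ℂ] HX => f ⟨c₂ W W' u, hx⟩) hφ0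
            simpa [φ] using this
          have h2 := c_add W W' (hle (hlift_mem _ hx))
          rw [h1, zero_add] at h2
          rw [hu', ← h2]
          exact c₂_mem W W' _
        rcases hW'.2.2 U hUle hU with h | h
        · exact absurd h hUbot
        · exact Or.inr (Or.inr (Or.inl h))
  · -- Case A: `U ⊓ W ≠ ⊥`, so `U ⊓ W = W`, `W ≤ U`, and the modular law
    have hUW_stable : HeckeStable G (U ⊓ W) := fun g a ha => ⟨hU g a ha.1, hW.2.1 g a ha.2⟩
    have hWU : W ≤ U := by
      rcases hW.2.2 (U ⊓ W) inf_le_right hUW_stable with h | h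
      · exact absurd h hUW
      · intro x hx
        have : x ∈ U ⊓ W := by
          rw [h]
          exact hx
        exact this.1
    have hmod : U = W ⊔ (W' ⊓ U) := by
      have := sup_inf_assoc_of_le W' hWU
      rw [inf_eq_right.mpr hle] at this
      exact this
    have hUW'_stable : HeckeStable G (W' ⊓ U) := fun g a ha => ⟨hW'.2.1 g a ha.1, hU g a ha.2⟩
    rcases hW'.2.2 (W' ⊓ U) inf_le_left hUW'_stable with h | h
    · rw [h, sup_bot_eq] at hmod
      exact Or.inr (Or.inl hmod)
    · rw [h] at hmod
      exact Or.inr (Or.inr (Or.inr hmod))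

/-! ## 3. Corollaries in the shape of (H9) and (H10) -/

include hadd in
/-- (H9), first clause, on `W ⊔ W'`: every stable `U ≤ W ⊔ W'` has a stable complement inside `W ⊔ W'` -/
theorem exists_compl_of_two {W W' U : Submodule ℂ HX} (hW : HeckeIrred G W) (hW' : HeckeIrred G W')
    (hdisj : W ⊓ W' = ⊥) (hhom : NoEquivariantMap G W' W hW'.2.1) (hU : HeckeStable G U)
    (hle : U ≤ W ⊔ W') :
    ∃ U' : Submodule ℂ HX, U' ≤ W ⊔ W' ∧ HeckeStable G U' ∧ U ⊓ U' = ⊥ ∧ U ⊔ U' = W ⊔ W' := by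
  rcases stable_le_sup_cases hadd hW hW' hdisj hhom hU hle with h | h | h | h
  · exact ⟨W ⊔ W', le_rfl, fun g a ha => by
      rcases Submodule.mem_sup.mp ha with ⟨w, hw, w', hw', rfl⟩
      rw [hadd]
      exact Submodule.mem_sup.mpr ⟨_, hW.2.1 g w hw, _, hW'.2.1 g w' hw', rfl⟩,
      by rw [h, bot_inf_eq], by rw [h, bot_sup_eq]⟩
  · exact ⟨W', le_sup_right, hW'.2.1, by rw [h, hdisj], by rw [h]⟩
  · exact ⟨W, le_sup_left, hW.2.1, by rw [h, inf_comm, hdisj], by rw [h, sup_comm]⟩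
  · exact ⟨⊥, bot_le, fun g a ha => by
      rw [Submodule.mem_bot] at ha ⊢
      subst ha
      have h0 := hadd g 0 0
      rw [add_zero] at h0
      exact add_left_cancel (h0.symm.trans (add_zero _).symm),
      inf_bot_eq _, by rw [h, sup_bot_eq]⟩

include hadd in
/-- (H9), second clause, on `W ⊔ W'`: a non-zero stable `U ≤ W ⊔ W'` contains an irreducible -/
theorem exists_irred_le_of_two {W W' U : Submodule ℂ HX} (hW : HeckeIrred G W) (hW' : HeckeIrred G W')
    (hdisj : W ⊓ W' = ⊥) (hhom : NoEquivariantMap G W' W hW'.2.1) (hU : HeckeStable G U)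
    (hle : U ≤ W ⊔ W') (hne : U ≠ ⊥) : ∃ Y : Submodule ℂ HX, Y ≤ U ∧ HeckeIrred G Y := by
  rcases stable_le_sup_cases hadd hW hW' hdisj hhom hU hle with h | h | h | h
  · exact absurd h hne
  · exact ⟨W, h ▸ le_rfl, hW⟩
  · exact ⟨W', h ▸ le_rfl, hW'⟩
  · exact ⟨W, h ▸ le_sup_left, hW⟩

include hadd in
/-- the irreducibles inside `W ⊔ W'` are exactly `W` and `W'` -/
theorem irred_le_sup_eq {W W' Y : Submodule ℂ HX} (hW : HeckeIrred G W) (hW' : HeckeIrred G W')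
    (hdisj : W ⊓ W' = ⊥) (hhom : NoEquivariantMap G W' W hW'.2.1) (hY : HeckeIrred G Y)
    (hle : Y ≤ W ⊔ W') : Y = W ∨ Y = W' := by
  rcases stable_le_sup_cases hadd hW hW' hdisj hhom hY.2.1 hle with h | h | h | h
  · exact absurd h hY.1
  · exact Or.inl h
  · exact Or.inr h
  · -- `W ⊔ W'` is not irreducible: `W` is a proper non-zero stable subspace
    exfalso
    rcases hY.2.2 W (h ▸ le_sup_left) hW.2.1 with hb | hb
    · exact hW.1 hb
    · -- `W = W ⊔ W'` forces `W' ≤ W`, so `W' = W ⊓ W' = ⊥`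
      apply hW'.1
      rw [eq_bot_iff, ← hdisj]
      refine le_inf ?_ le_rfl
      rw [hb, h]
      exact le_sup_right

include hadd in
/-- (H10) on `W ⊔ W'`: two irreducibles inside `W ⊔ W'` joined by a non-zero equivariant map coincide, given
`NoEquivariantMap` in both directions -/
theorem eq_of_equivariant_of_two {W W' : Submodule ℂ HX} (hW : HeckeIrred G W) (hW' : HeckeIrred G W')
    (hdisj : W ⊓ W' = ⊥) (hhom : NoEquivariantMap G W' W hW'.2.1) (hhom' : NoEquivariantMap G W W' hW.2.1)
    {U U' : Submodule ℂ HX} (hU : HeckeIrred G U) (hU' : HeckeIrred G U') (hUle : U ≤ W ⊔ W')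
    (hU'le : U' ≤ W ⊔ W') (φ : U →ₗ[ℂ] HX) (hφ : ∀ x : U, φ x ∈ U')
    (hφeq : ∀ (g : G) (x : U), φ ⟨g • (x : HX), hU.2.1 g x x.2⟩ = g • φ x) (hφne : φ ≠ 0) : U = U' := by
  rcases irred_le_sup_eq hadd hW hW' hdisj hhom hU hUle with h | h <;>
    rcases irred_le_sup_eq hadd hW hW' hdisj hhom hU' hU'le with h' | h'
  · exact h.trans h'.symm
  · -- a non-zero equivariant map `W → W'`: excluded
    exfalso
    subst h
    subst h'
    exact hφne (hhom' φ hφ hφeq)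
  · -- a non-zero equivariant map `W' → W`: excluded
    exfalso
    subst h
    subst h'
    exact hφne (hhom φ hφ hφeq)
  · exact h.trans h'.symm

end Main

end

end Summit.Ventures.HodgeRepro2.Tier7.Line1
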